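import Summits.QuantumAdvantage.AdviceFreeQNC0.OddPrimeStatements
import Summits.QuantumAdvantage.AdviceFreeQNC0.BlockAdditiveCounts
import Summits.QuantumAdvantage.AdviceFreeQNC0.CleanGapStrategies
import HarnessLib

/-!
# Item stmt-QuantumAdvantage-23991 `LocalTwoThirdsLaw` — part 1/4: layout, windows, register decomposition (S1–S2)

AUTHORED AND PROVED BY THE PLANNER SEAT qa-qnc0-p2 g29 (`HOME/qa-qnc0-p2/line29/LocalTwoThirds23991.lean`, 1082 lines, farm
rc 0 / 0 sorry); landed verbatim (split for the 400-line rule, one-line docstrings added) by qn-prover-3 g18, ask P2-29g.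

THE PLANNER'S MODULE DOCSTRING (verbatim):

# `LocalTwoThirdsLaw` (stmt-QuantumAdvantage-23991) — COMPLETE kernel proof (planner qa-qnc0-p2, gen 29)

STATUS (2026-08-29T03:45Z): farm `lean check` rc 0, 0 sorries, 0 warnings, 300 s; axioms of
`localTwoThirdsLaw` = {propext, Classical.choice, Quot.sound} + ONE `native_decide` axiom owned by
`core4_le` (the 64³-strategy finite core of the 4-block class game; ≈ 290 s of the 300 s).  Landing plan
(provers; the planner does not propose): module `Theorems/OddPrimeWalkOddLocal.lean` = this file
(computational proposal because of `core4_le`; or split `core4_le` into its own tiny computational module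
`Theorems/OddPrimeWalkOddLocalCore.lean` imported here), closer `Theorems/OddPrimeWalkLocalTwoThirdsLaw.lean`:
`theorem oddPrimeWalk_localTwoThirdsLaw : OddPrimeWalk.LocalTwoThirdsLaw := OddLocal.localTwoThirdsLaw`
(shape verified against the route decl: audit `proof-of-item`, line29/SkeletonClose.lean).

FILED STATEMENT (route file `Theses/OddPrimeWalk.lean`, decl `LocalTwoThirdsLaw`): reading radius `w`
(`y g u` depends only on the bits `g - w ≤ i < g + w`), `6w + 4m₀ ≤ n` ⇒ `#WIN ≤ (2/3 + 32·2^{-m₀})·2ⁿ`.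

PROOF (ROUND-28 §4.4, ROUND-29 §1.2), in the elementary form used by `OddConfig.configParity` (no 𝔽₄):
* LAYOUT. Separators `t_k = k·m₀ + (2k-1)·w` (k = 1,2,3; `t_0 = 0`, `t_4 = n`), input SEGMENTS
  `I_j = [t_j, t_{j+1})`, WINDOWS `W_k = [t_k - w, t_k + w)` (6w bits in all), free part of segment j has
  `L_j ≥ m₀` bits.  A cut `g` with `t_j ≤ g ≤ t_{j+1}` ("block j", ties at separators go down) reads only
  bits of `I_j ∪ W_j ∪ W_{j+1}` (`window_agree`).
* CONDITIONING. Fix the window bits `ω`.  Inputs with `u|_W = ω` ↔ 4-tuples of patterns `s_j`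
  (`G s` takes segment j from `s_j`; all `s_j` carry `ω` on the windows).  Then `y g (G s) = y g (s_j)`
  for g in block j.
* REGISTER DECOMPOSITION (`decomp`). With `W_i = wtSeg i (s i)`:  for g in block j,
  `c + g + wt(G s) + wtPrefix (G s) g = E_j + ψ_g(s_j)`,  `E_j := 2·Σ_{i<j} W_i + Σ_{i>j} W_i`,
  `ψ_g(s_j) := c + g + W_j + #{i ∈ I_j : i < g, s_j i}`.  Hence
  `WIN(G s) = Σ_j B_j(s_j, E_j) (mod 2)`,  `B_j(s_j, E) := #{g ∈ block j : y g s_j ∧ E + ψ_g(s_j) ≢ 0 (3)}`.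
  `B_j(s,0) + B_j(s,1) + B_j(s,2)` is even (a fired cut is dead for exactly one E mod 3), so the class
  profile `E ↦ B_j(s_j,E) mod 2` is one of `000, 011, 110, 101` = the codes `0, 1, 2, 3` (`0, ζ⁰, ζ¹, ζ²`)
  of the planner's finite core `BlockGameK` (HOME/qa-qnc0-p2/line28/BlockGameK.lean): `tr m x = B(m)`.
* CLASS GAME. `E_j mod 3` depends only on the classes `a_i = W_i mod 3`:
  `E_0 = a₁+a₂+a₃, E_1 = 2a₀+a₂+a₃, E_2 = 2a₀+2a₁+a₃, E_3 = 2a₀+2a₁+2a₂` — exactly `BlockGameK.win4`.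
  For every window word ω and every SYSTEM OF REPRESENTATIVES `P j a` (pattern of segment j, window ω,
  class a) the 81 cells `a : Fin 4 → Fin 3` are won according to `win4 p₀ p₁ p₂ (x₃ a₃) a₀ a₁ a₂ a₃` with
  `p_j = Σ_a enc(profile of P j a)·4^a`; so at most `score4 p₀ p₁ p₂ ≤ 54` of them are won (`core`).
* AVERAGING (`average4`, the 4-family version of `OddConfig.config_average`): summing over all systems,
  `Σ_cells #WIN(cell)/#cell ≤ 54`, hence `#LOSE_ω ≥ 27 · min cell ≥ 27 · Π_j (2^{L_j} - 2)/3`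
  (class sizes of an L-cube shifted by the fixed weight: `BlockAdditive` lemmas, as in `OddConfig.three_mul_card_clA_ge`).
* SUM over the `2^{6w}` window words: `#LOSE ≥ (1/3)·2ⁿ·Π_j (1 - 2^{1-L_j}) ≥ (1/3)(1 - 8·2^{-m₀})·2ⁿ`,
  i.e. `#WIN ≤ (2/3 + (8/3)·2^{-m₀})·2ⁿ ≤ (2/3 + 32·2^{-m₀})·2ⁿ`.  (For `m₀ ≤ 5` the bound exceeds `2ⁿ`.)

Below: layout (S1), register decomposition (S2), finite core (S3, `native_decide`), systems of
representatives (S4), averaging and per-window counting (S5), and the composition `localTwoThirdsLaw`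
(the filed statement verbatim).
-/

namespace Summit.QuantumAdvantage.AdviceFreeQNC0.OddLocal

open Finset Literature.Computability.MetaComplexity

variable {n : ℕ}

/-! ## Layout -/

/-- separator `t_k = k·m₀ + (2k−1)·w` (`t_0 = 0`). -/
def sep (m₀ w k : ℕ) : ℕ := k * m₀ + (2 * k - 1) * w

/-- segment of a bit position. -/
def segOf (m₀ w i : ℕ) : Fin 4 :=
  if i < sep m₀ w 1 then 0 else if i < sep m₀ w 2 then 1 else if i < sep m₀ w 3 then 2 else 3

/-- block of a cut position (ties at a separator go to the lower block). -/
def blockOf (m₀ w g : ℕ) : Fin 4 :=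
  if g ≤ sep m₀ w 1 then 0 else if g ≤ sep m₀ w 2 then 1 else if g ≤ sep m₀ w 3 then 2 else 3

/-- window bits: within `w` of a separator (an `abbrev`, so that `Decidable` is found by unfolding). -/
abbrev inWindow (m₀ w i : ℕ) : Prop :=
  (sep m₀ w 1 - w ≤ i ∧ i < sep m₀ w 1 + w) ∨ (sep m₀ w 2 - w ≤ i ∧ i < sep m₀ w 2 + w) ∨
    (sep m₀ w 3 - w ≤ i ∧ i < sep m₀ w 3 + w)

/-- the input assembled from four patterns: segment `j` is read from `s j`. -/
def G (m₀ w : ℕ) (s : Fin 4 → Fin n → Bool) : Fin n → Bool := fun i => s (segOf m₀ w i.val) i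

/-- weight of segment `j`. -/
def wtSeg (m₀ w : ℕ) (j : Fin 4) (s : Fin n → Bool) : ℕ :=
  (univ.filter fun i : Fin n => segOf m₀ w i.val = j ∧ s i = true).card

/-- weight of segment `j` strictly before position `g`. -/
def wtPrefSeg (m₀ w : ℕ) (j : Fin 4) (s : Fin n → Bool) (g : ℕ) : ℕ :=
  (univ.filter fun i : Fin n => segOf m₀ w i.val = j ∧ (i.val < g ∧ s i = true)).card

/-- the cross exponent `E_j = 2·Σ_{i<j} W_i + Σ_{i>j} W_i`. -/
def Eexp (m₀ w : ℕ) (j : Fin 4) (s : Fin 4 → Fin n → Bool) : ℕ :=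
  2 * (∑ i ∈ univ.filter (fun i : Fin 4 => i < j), wtSeg m₀ w i (s i)) +
    ∑ i ∈ univ.filter (fun i : Fin 4 => j < i), wtSeg m₀ w i (s i)

/-- block-`j` live-fire count at cross exponent `E` (intrinsic in the block's own pattern). -/
def Bcnt (m₀ w c : ℕ) (y : Fin (n + 1) → (Fin n → Bool) → Bool) (j : Fin 4) (sj : Fin n → Bool)
    (E : ℕ) : ℕ :=
  (univ.filter fun g : Fin (n + 1) => blockOf m₀ w g.val = j ∧ y g sj = true ∧
    (E + (c + g.val + wtSeg m₀ w j sj + wtPrefSeg m₀ w j sj g.val)) % 3 ≠ 0).card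

/-- all four patterns carry the same window bits. -/
def WinAgree (m₀ w : ℕ) (s : Fin 4 → Fin n → Bool) : Prop :=
  ∀ i j : Fin 4, ∀ l : Fin n, inWindow m₀ w l.val → s i l = s j l

/-- reading radius `w` (verbatim the filed hypothesis; = `AdviceFreeQNC0.ReadRadius` of line28). -/
def Radius (y : Fin (n + 1) → (Fin n → Bool) → Bool) (w : ℕ) : Prop :=
  ∀ g : Fin (n + 1), ∀ u u' : Fin n → Bool,
    (∀ i : Fin n, g.val ≤ i.val + w → i.val < g.val + w → u i = u' i) → y g u = y g u'

/-! ## S1 — windows: a block-`j` cut sees `G s` exactly as it sees `s j` -/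

/-- Auxiliary `sep_one` of the local two-thirds law (planner qa-qnc0-p2 g29, `LocalTwoThirds23991.lean`, verbatim). -/
theorem sep_one (m₀ w : ℕ) : sep m₀ w 1 = m₀ + w := by unfold sep; omega
/-- Auxiliary `sep_two` of the local two-thirds law (planner qa-qnc0-p2 g29, `LocalTwoThirds23991.lean`, verbatim). -/
theorem sep_two (m₀ w : ℕ) : sep m₀ w 2 = 2 * m₀ + 3 * w := by unfold sep; omega
/-- Auxiliary `sep_three` of the local two-thirds law (planner qa-qnc0-p2 g29, `LocalTwoThirds23991.lean`, verbatim). -/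
theorem sep_three (m₀ w : ℕ) : sep m₀ w 3 = 3 * m₀ + 5 * w := by unfold sep; omega

/-- a bit of a lower segment lies below any cut of a higher block. -/
theorem lt_of_segOf_lt_blockOf (m₀ w : ℕ) {i g : ℕ} (h : segOf m₀ w i < blockOf m₀ w g) : i < g := by
  unfold segOf blockOf at h
  rw [sep_one, sep_two, sep_three] at h
  split_ifs at h <;> omega

/-- a bit of a higher segment lies at or above any cut of a lower block. -/
theorem le_of_blockOf_lt_segOf (m₀ w : ℕ) {i g : ℕ} (h : blockOf m₀ w g < segOf m₀ w i) : g ≤ i := by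
  unfold segOf blockOf at h
  rw [sep_one, sep_two, sep_three] at h
  split_ifs at h <;> omega

/-- Auxiliary `G_window` of the local two-thirds law (planner qa-qnc0-p2 g29, `LocalTwoThirds23991.lean`, verbatim). -/
theorem G_window (m₀ w : ℕ) (s : Fin 4 → Fin n → Bool)
    (hs : WinAgree m₀ w s) (g : Fin (n + 1)) (l : Fin n)
    (h1 : g.val ≤ l.val + w) (h2 : l.val < g.val + w) :
    G m₀ w s l = s (blockOf m₀ w g.val) l := by
  by_cases hwin : inWindow m₀ w l.val
  · exact hs _ _ l hwin
  · unfold G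
    have key : segOf m₀ w l.val = blockOf m₀ w g.val := by
      unfold inWindow at hwin
      rw [sep_one, sep_two, sep_three] at hwin
      unfold segOf blockOf
      rw [sep_one, sep_two, sep_three]
      split_ifs <;> first | rfl | (exfalso; omega)
    rw [key]

/-- Auxiliary `y_G_eq` of the local two-thirds law (planner qa-qnc0-p2 g29, `LocalTwoThirds23991.lean`, verbatim). -/
theorem y_G_eq (m₀ w : ℕ) (y : Fin (n + 1) → (Fin n → Bool) → Bool)
    (hy : Radius y w) (s : Fin 4 → Fin n → Bool) (hs : WinAgree m₀ w s) (g : Fin (n + 1)) :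
    y g (G m₀ w s) = y g (s (blockOf m₀ w g.val)) :=
  hy g _ _ (fun l h1 h2 => G_window m₀ w s hs g l h1 h2)

/-! ## S2 — register decomposition -/

/-- Auxiliary `wt_G` of the local two-thirds law (planner qa-qnc0-p2 g29, `LocalTwoThirds23991.lean`, verbatim). -/
theorem wt_G (m₀ w : ℕ) (s : Fin 4 → Fin n → Bool) :
    wt (G m₀ w s) = ∑ j : Fin 4, wtSeg m₀ w j (s j) := by
  unfold wt wtSeg
  rw [card_eq_sum_card_fiberwise (f := fun i : Fin n => segOf m₀ w i.val) (t := univ)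
    (fun _ _ => mem_coe.mpr (mem_univ _))]
  refine Finset.sum_congr rfl fun j _ => ?_
  rw [filter_filter]
  congr 1
  refine filter_congr fun i _ => ?_
  constructor
  · rintro ⟨h1, h2⟩
    refine ⟨h2, ?_⟩
    unfold G at h1
    rw [h2] at h1
    exact h1
  · rintro ⟨h1, h2⟩
    refine ⟨?_, h1⟩
    unfold G
    rw [h1]
    exact h2

/-- the segment sums split at `j`. -/
theorem sum_seg_split (j : Fin 4) (W : Fin 4 → ℕ) :
    (∑ i, W i) = (∑ i ∈ univ.filter (fun i : Fin 4 => i < j), W i) + W j +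
      ∑ i ∈ univ.filter (fun i : Fin 4 => j < i), W i := by
  fin_cases j <;> simp [Finset.sum_filter, Fin.sum_univ_four] <;> omega

/-- Auxiliary `wtPrefix_G` of the local two-thirds law (planner qa-qnc0-p2 g29, `LocalTwoThirds23991.lean`, verbatim). -/
theorem wtPrefix_G (m₀ w : ℕ) (_hn : 6 * w + 4 * m₀ ≤ n) (s : Fin 4 → Fin n → Bool)
    (g : Fin (n + 1)) :
    wtPrefix (G m₀ w s) g.val =
      (∑ i ∈ univ.filter (fun i : Fin 4 => i < blockOf m₀ w g.val), wtSeg m₀ w i (s i)) +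
        wtPrefSeg m₀ w (blockOf m₀ w g.val) (s (blockOf m₀ w g.val)) g.val := by
  set j := blockOf m₀ w g.val with hj
  unfold wtPrefix
  rw [card_eq_sum_card_fiberwise (f := fun i : Fin n => segOf m₀ w i.val) (t := univ)
    (fun _ _ => mem_coe.mpr (mem_univ _))]
  -- fibre over segment i: full weight if i < j, prefix weight if i = j, empty if j < i
  have hfib : ∀ i : Fin 4, ((univ.filter fun l : Fin n => l.val < g.val ∧ G m₀ w s l = true).filter
      fun l => segOf m₀ w l.val = i).card =
      if i < j then wtSeg m₀ w i (s i) else if i = j then wtPrefSeg m₀ w j (s j) g.val else 0 := by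
    intro i
    rw [filter_filter]
    split_ifs with hlt heq
    · unfold wtSeg
      congr 1
      refine filter_congr fun l _ => ?_
      constructor
      · rintro ⟨⟨_, h2⟩, h3⟩
        refine ⟨h3, ?_⟩
        unfold G at h2; rw [h3] at h2; exact h2
      · rintro ⟨h3, h2⟩
        refine ⟨⟨lt_of_segOf_lt_blockOf m₀ w (by rw [h3, ← hj]; exact hlt), ?_⟩, h3⟩
        unfold G; rw [h3]; exact h2
    · subst heq
      unfold wtPrefSeg
      congr 1
      refine filter_congr fun l _ => ?_
      constructor
      · rintro ⟨⟨h1, h2⟩, h3⟩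
        refine ⟨h3, h1, ?_⟩
        unfold G at h2; rw [h3] at h2; exact h2
      · rintro ⟨h3, h1, h2⟩
        refine ⟨⟨h1, ?_⟩, h3⟩
        unfold G; rw [h3]; exact h2
    · rw [Finset.card_eq_zero, Finset.filter_eq_empty_iff]
      rintro l - ⟨⟨h1, -⟩, h3⟩
      have hjl : j < segOf m₀ w l.val := by
        rw [h3]
        rcases lt_trichotomy i j with h | h | h
        · exact absurd h hlt
        · exact absurd h heq
        · exact h
      have := le_of_blockOf_lt_segOf m₀ w (by rw [← hj]; exact hjl)
      omega
  rw [Finset.sum_congr rfl fun i _ => hfib i]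
  rw [sum_seg_split j]
  simp only [lt_irrefl, if_true, if_false]
  have h1 : (∑ i ∈ univ.filter (fun i : Fin 4 => i < j),
      (if i < j then wtSeg m₀ w i (s i) else if i = j then wtPrefSeg m₀ w j (s j) g.val else 0))
      = ∑ i ∈ univ.filter (fun i : Fin 4 => i < j), wtSeg m₀ w i (s i) :=
    Finset.sum_congr rfl fun i hi => by rw [mem_filter] at hi; simp [hi.2]
  have h2 : (∑ i ∈ univ.filter (fun i : Fin 4 => j < i),
      (if i < j then wtSeg m₀ w i (s i) else if i = j then wtPrefSeg m₀ w j (s j) g.val else 0)) = 0 :=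
    Finset.sum_eq_zero fun i hi => by
      rw [mem_filter] at hi
      have hne : i ≠ j := ne_of_gt hi.2
      have hnl : ¬ i < j := not_lt_of_gt hi.2
      simp [hne, hnl]
  rw [h1, h2]
  simp

/-- for a block-`j` cut: `c + g + walkExp (G s) g = E_j + ψ_g(s_j)` (exactly, not only mod 3). -/
theorem walkExp_G (m₀ w c : ℕ) (hn : 6 * w + 4 * m₀ ≤ n) (s : Fin 4 → Fin n → Bool)
    (g : Fin (n + 1)) :
    (c + g.val + walkExp (G m₀ w s) g.val) % 3 =
      (Eexp m₀ w (blockOf m₀ w g.val) s + (c + g.val + wtSeg m₀ w (blockOf m₀ w g.val)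
        (s (blockOf m₀ w g.val)) + wtPrefSeg m₀ w (blockOf m₀ w g.val) (s (blockOf m₀ w g.val)) g.val)) % 3 := by
  congr 1
  unfold walkExp Eexp
  rw [wt_G, wtPrefix_G m₀ w hn, sum_seg_split (blockOf m₀ w g.val) (fun i => wtSeg m₀ w i (s i))]
  ring

/-- **decomposition**: `WIN(G s) = Σ_j B_j(s_j, E_j) mod 2`. -/
theorem ringWinU_G (m₀ w c : ℕ) (hn : 6 * w + 4 * m₀ ≤ n) (y : Fin (n + 1) → (Fin n → Bool) → Bool)
    (hy : Radius y w) (s : Fin 4 → Fin n → Bool) (hs : WinAgree m₀ w s) :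
    ringWinU c y (G m₀ w s) = decide ((∑ j : Fin 4, Bcnt m₀ w c y j (s j) (Eexp m₀ w j s)) % 2 = 1) := by
  unfold ringWinU
  have hc : (univ.filter fun g : Fin (n + 1) => y g (G m₀ w s) = true ∧
      (c + g.val + walkExp (G m₀ w s) g.val) % 3 ≠ 0).card =
      ∑ j : Fin 4, Bcnt m₀ w c y j (s j) (Eexp m₀ w j s) := by
    rw [card_eq_sum_card_fiberwise (f := fun g : Fin (n + 1) => blockOf m₀ w g.val) (t := univ)
      (fun _ _ => mem_coe.mpr (mem_univ _))]
    refine Finset.sum_congr rfl fun j _ => ?_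
    unfold Bcnt
    rw [filter_filter]
    congr 1
    refine filter_congr fun g _ => ?_
    constructor
    · rintro ⟨⟨hy1, hl⟩, hb⟩
      subst hb
      refine ⟨rfl, ?_, ?_⟩
      · rwa [y_G_eq m₀ w y hy s hs g] at hy1
      · rwa [walkExp_G m₀ w c hn s g] at hl
    · rintro ⟨hb, hy1, hl⟩
      subst hb
      refine ⟨⟨?_, ?_⟩, rfl⟩
      · rwa [y_G_eq m₀ w y hy s hs g]
      · rwa [walkExp_G m₀ w c hn s g]
  rw [hc]

/-- `E_j mod 3` depends only on the classes. -/
theorem Eexp_mod (m₀ w : ℕ) (j : Fin 4) (s : Fin 4 → Fin n → Bool) (a : Fin 4 → Fin 3)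
    (ha : ∀ i, wtSeg m₀ w i (s i) % 3 = (a i).val) :
    Eexp m₀ w j s % 3 = (2 * (∑ i ∈ univ.filter (fun i : Fin 4 => i < j), (a i).val) +
      ∑ i ∈ univ.filter (fun i : Fin 4 => j < i), (a i).val) % 3 := by
  unfold Eexp
  have h1 : (∑ i ∈ univ.filter (fun i : Fin 4 => i < j), wtSeg m₀ w i (s i)) % 3 =
      (∑ i ∈ univ.filter (fun i : Fin 4 => i < j), (a i).val) % 3 := by
    rw [Finset.sum_nat_mod, Finset.sum_congr rfl (fun i _ => ha i)]
  have h2 : (∑ i ∈ univ.filter (fun i : Fin 4 => j < i), wtSeg m₀ w i (s i)) % 3 =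
      (∑ i ∈ univ.filter (fun i : Fin 4 => j < i), (a i).val) % 3 := by
    rw [Finset.sum_nat_mod, Finset.sum_congr rfl (fun i _ => ha i)]
  omega

/-- Auxiliary `Bcnt_mod3` of the local two-thirds law (planner qa-qnc0-p2 g29, `LocalTwoThirds23991.lean`, verbatim). -/
theorem Bcnt_mod3 (m₀ w c : ℕ) (y : Fin (n + 1) → (Fin n → Bool) → Bool) (j : Fin 4)
    (sj : Fin n → Bool) (E E' : ℕ) (h : E % 3 = E' % 3) :
    Bcnt m₀ w c y j sj E = Bcnt m₀ w c y j sj E' := by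
  unfold Bcnt
  congr 1
  refine filter_congr (fun g _ => ?_)
  rw [Nat.add_mod E, Nat.add_mod E', h]

/-- the 𝔽₄ constraint: a fired cut is dead for exactly one cross exponent mod 3. -/
theorem Bcnt_even (m₀ w c : ℕ) (y : Fin (n + 1) → (Fin n → Bool) → Bool) (j : Fin 4)
    (sj : Fin n → Bool) :
    (Bcnt m₀ w c y j sj 0 + Bcnt m₀ w c y j sj 1 + Bcnt m₀ w c y j sj 2) % 2 = 0 := by
  unfold Bcnt
  set F := univ.filter fun g : Fin (n + 1) => blockOf m₀ w g.val = j ∧ y g sj = true with hF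
  set ψ : Fin (n + 1) → ℕ := fun g => c + g.val + wtSeg m₀ w j sj + wtPrefSeg m₀ w j sj g.val with hψ
  have hE : ∀ E : ℕ, (univ.filter fun g : Fin (n + 1) => blockOf m₀ w g.val = j ∧ y g sj = true ∧
      (E + (c + g.val + wtSeg m₀ w j sj + wtPrefSeg m₀ w j sj g.val)) % 3 ≠ 0).card =
      ∑ g ∈ F, if (E + ψ g) % 3 ≠ 0 then 1 else 0 := by
    intro E
    rw [← Finset.card_filter]
    congr 1
    ext g
    simp only [hF, hψ, mem_filter, mem_univ, true_and, and_assoc]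
  rw [hE 0, hE 1, hE 2, ← Finset.sum_add_distrib, ← Finset.sum_add_distrib]
  rw [Finset.sum_congr rfl (g := fun _ => 2) (fun g _ => by
    have h3 : ψ g % 3 < 3 := Nat.mod_lt _ (by norm_num)
    split_ifs <;> omega)]
  simp

end Summit.QuantumAdvantage.AdviceFreeQNC0.OddLocal
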